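import Literature.NumberTheory.LFunctions.EvenCharacterSecondOrderAbelBound
import Literature.NumberTheory.LFunctions.ExplicitExceptionalZeroBoundsRealCharacters
import Literature.NumberTheory.LFunctions.DirichletLSeriesDeriv
import Literature.NumberTheory.LFunctions.RealCharacterLadderLeaves
import Mathlib.Analysis.SpecialFunctions.Pow.Asymptotics
import Mathlib.Analysis.SpecialFunctions.Log.Monotone
import Mathlib.Analysis.SumIntegralComparisons
import Mathlib.Analysis.Convex.Deriv
import HarnessLib

/-!
# Bordignon 2020: `|L′(σ,χ)| ≤ ⅛ log² q` near `1` for even real primitive `χ` (Theorem 1.1, PROVED)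
# and the exceptional-zero bound `β₀ ≤ 1 − 100/(√q log² q)` (Theorem 1.3)

Topic `Literature/NumberTheory/LFunctions` (Parity programme, cell `parity-realchar`, TARGET §2 rows 9
and 12: instrument provenance of the even-character column). Companion of
`ExplicitExceptionalZeroBoundsRealCharacters` (which states `bordignon2020_theorem13` as a named fact and
PROVES Theorem 1.2, `bordignon2020_theorem12 : L(1,χ) ≥ 12.52/√q`) and of
`EvenCharacterSecondOrderAbelBound` (Theorem 2.1 of the source = Louboutin's second-order Abel
summation bound, PROVED as `DirichletAbel.bordignon2020_theorem21` / `norm_lim_le_secondOrder`).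

## Main results (all sorry-free; no new named fact)

* `Bordignon2020.bordignon2020_theorem11` — **Theorem 1.1 as printed**: for `q > 4·10⁵`, `χ` mod `q`
  primitive, real and even, and `1 − 100/(√q log² q) ≤ σ ≤ 1`: `‖L′(σ,χ)‖ ≤ ⅛ log² q`.
* `Bordignon2020.one_sub_realZero_bordignon_even_primitive` — **Theorem 1.3 for primitive `χ`** (and
  every real zero `β < 1`, not only the exceptional one): `β ≤ 1 − 100/(√q log² q)`.
* `Bordignon2020.one_sub_realZero_bordignon_even_of_noExceptionalZeroUpTo`,
  `Bordignon2020.bordignon2020_theorem13_of_noExceptionalZeroUpTo`,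
  `Bordignon2020.bordignon2020_theorem13_of_platt` — **Theorem 1.3 for all even non-principal real
  `χ`** (the named fact `bordignon2020_theorem13`), modulo exactly what the printed proof invokes for an
  imprimitive `χ` induced from `q′ ≤ 4·10⁵`: Platt's certified computation, entering either as the
  narrow leaf `NoExceptionalZeroUpTo_4e5_fifth` or as `platt2016_theorem71`. So the 2020 theorem
  carries no debt beyond Platt's table.
* STRICT forms `Bordignon2020.realZero_lt_bordignon_even_primitive` /
  `realZero_lt_bordignon_even_of_noExceptionalZeroUpTo` (`β < 1 − 100/(√q log² q)`: the slack
  `12.5 < 12.52` of the printed argument), and with them **BGTZ 2025 Theorem 2.8 — the named fact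
  `BGTZ2025.theorem28_bordignon` (`HypothesisB 100 (1/2)`, strict `<` at `B = 100` as BGTZ print it) —
  DISCHARGED modulo the four instrument facts** `watkins2004_theorem`, `watkins2004_table4`,
  `platt2016_theorem71`, `McCurley1984_theorem1`: `BGTZ2025.theorem28_bordignon_of_watkins_platt_mccurley`
  (via `BGTZ2025.hypothesisB_half_of_real_clause`, the Platt/McCurley reduction of Hypothesis 2.6 to its
  real-character clause, and `BGTZ2025.realZero_lt_hundred_of_watkins_platt`).

## The printed proof, and how it is followed

§2.2 of the source: Theorem 2.1 (second-order Abel summation with `k = 4`, here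
`DirichletAbel.norm_lim_le_secondOrder`) applied to `f(n) = g_σ(n) = log n · n^{−σ}`, which is
decreasing for `n ≥ 4` and has non-negative second differences for `n ≥ 4` («as
`f(4) − 2f(5) + f(6) ≥ 0` and `f` is convex for `n ≥ 5`»; here `antitoneOn_g`, `convexOn_g` by
calculus and `secondDiff_g_four_nonneg` by decimal bounds on `log 2, log 3, log 5`); `L′(σ,χ) =
−∑ χ(n) g_σ(n)` as the limit of the partial sums (`tendsto_sum_Ico_four_g_mul_apply`, from the tree's
Abel-summation toolkit `DirichletAbel.deriv_LFunction_eq_tsum`); and the numerical estimate of the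
right-hand side `R(A,σ)` with `A = ⌊√q⌋ − 1`: `∑_{m ≤ A} log m/m ≤ ½ log² A + 0.11`
(`sum_log_div_le`, the source's partial summation with `d = 100` replaced by an integral comparison
from `3`), `A^{1−σ} ≤ exp(50/(√q log q)) ≤ 1 + y + y²`, `log q ≤ √q/16` (`q ≥ 5⁸`), and the sign of the
`−((A−3)/2) f(A+1)` term; the final margin is `≈ 0.3` (out of `⅛ log² q ≥ 19.5`). The source reports
the sharper outcome «`|L′(σ,χ)| ≤ 0.125 log² q` already with `c = 100`» from a numerical evaluation of
`R(A,σ)`; the constants above are the hand-checkable version of that evaluation.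

Theorem 1.3: by (4) of the source (`L(1,χ) = |L′(σ,χ)|(1 − β₀)`, here the mean-value inequality
`DirichletAbel.norm_LFunction_one_sub_le_of_norm_deriv_le`), a zero inside the window would force
`L(1,χ) ≤ ⅛ log² q · 100/(√q log² q) = 12.5/√q < 12.52/√q`, contradicting Theorem 1.2. The reduction
of an imprimitive `χ` to `χ⋆` mod `q′` is the tree's standard one
(`one_sub_realZero_bordignon_odd_of_watkins`): `q′ > 4·10⁵` uses the primitive case at level `q′` and the
monotonicity of `√x log² x`; `q′ ≤ 4·10⁵` uses the leaf (`500 log q′ ≤ √q log² q`).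

## References

* [Bordignon2020] M. Bordignon, *Explicit bounds on exceptional zeroes of Dirichlet L-functions II*,
  J. Number Theory 210 (2020) 481–518, arXiv:1907.08327 — Theorems 1.1, 1.3, §2.2 (pp. 2, 5–6).
* [Louboutin2002EvenL1] S. Louboutin, *Explicit upper bounds for |L(1,χ)| for primitive even Dirichlet
  characters*, Acta Arith. 101 (2002) 1–18 — §4 (the second-order summation behind Theorem 2.1).
* [MontgomeryVaughan2007] H. L. Montgomery, R. C. Vaughan, *Multiplicative Number Theory I*, CUP 2007 —
  §1.3 Thm. 1.3 (Abel summation), §4.3, §11.2.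
* [Platt2016GRH] D. J. Platt, *Numerical computations concerning the GRH*, Math. Comp. 85 (2016)
  3009–3027 — Theorem 7.1.
* [LuZamanZhao2026] (the narrow leaf `NoExceptionalZeroUpTo_4e5_fifth` of `RealCharacterLadderLeaves`).
* [BenliGoelTwissZaman2025] Hypothesis 2.6, Theorem 2.8; [McCurley1984ZFR] Theorem 1;
  [Watkins2004ClassNumbers] Table 4; [Bordignon2019] Theorem 1.3 (odd clause, via the tree's
  `one_sub_realZero_bordignon_odd_of_watkins`).
-/

noncomputable section

open Finset Complex Filter Topology

namespace Literature.NumberTheory.LFunctions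

namespace Bordignon2020

/-! ### Numerical constants -/

/-- `log 3 > 1.0986121`. [folklore] -/
private theorem log_three_gt : (1.0986121 : ℝ) < Real.log 3 := by
  have h := Real.abs_log_sub_add_sum_range_le (x := (1 / 3 : ℝ)) (by rw [abs_of_pos (by norm_num)]; norm_num) 14
  rw [abs_of_pos (by norm_num : (0 : ℝ) < 1 / 3)] at h
  have hs : ∑ i ∈ range 14, (1 / 3 : ℝ) ^ (i + 1) / (i + 1) = 11092950499 / 27358582680 := by
    simp only [sum_range_succ, sum_range_zero]
    norm_num
  rw [hs, show (1 : ℝ) - 1 / 3 = 2 / 3 by norm_num, Real.log_div (by norm_num) (by norm_num)] at h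
  have h2 := Real.log_two_gt_d9
  have h' := (abs_le.1 h).2
  norm_num at h'
  linarith

/-- `1.6094378 < log 5 < 1.6094385`. [folklore] -/
private theorem log_five_bounds : (1.6094378 : ℝ) < Real.log 5 ∧ Real.log 5 < 1.6094385 := by
  have h := Real.abs_log_sub_add_sum_range_le (x := (1 / 5 : ℝ)) (by rw [abs_of_pos (by norm_num)]; norm_num) 10
  rw [abs_of_pos (by norm_num : (0 : ℝ) < 1 / 5)] at h
  have hv : ∑ i ∈ range 10, (1 / 5 : ℝ) ^ (i + 1) / (i + 1) = 5491423277 / 24609375000 := by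
    simp only [sum_range_succ, sum_range_zero]
    norm_num
  have h45 : Real.log ((1 : ℝ) - 1 / 5) = 2 * Real.log 2 - Real.log 5 := by
    rw [show (1 : ℝ) - 1 / 5 = 2 ^ 2 / 5 by norm_num, Real.log_div (by norm_num) (by norm_num),
      Real.log_pow]; push_cast; ring
  rw [hv, h45] at h
  have h2 := Real.log_two_lt_d9
  have h2' := Real.log_two_gt_d9
  have h' := abs_le.1 h
  norm_num at h'
  constructor <;> nlinarith [h'.1, h'.2]

/-- `log 4 = 2 log 2`, `log 6 = log 2 + log 3`. [folklore] -/
private theorem log_four_eq : Real.log 4 = 2 * Real.log 2 := by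
  rw [show (4 : ℝ) = 2 ^ 2 by norm_num, Real.log_pow]; push_cast; ring

/-- `log 6 = log 2 + log 3`. [folklore] -/
private theorem log_six_eq : Real.log 6 = Real.log 2 + Real.log 3 := by
  rw [show (6 : ℝ) = 2 * 3 by norm_num, Real.log_mul (by norm_num) (by norm_num)]

/-- `exp y ≤ 1 + y + y²` for `|y| ≤ 1`. [folklore] -/
private theorem exp_le_one_add_add_sq {y : ℝ} (hy : |y| ≤ 1) : Real.exp y ≤ 1 + y + y ^ 2 := by
  have := Real.abs_exp_sub_one_sub_id_le hy
  have := (abs_le.1 this).2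
  linarith

/-! ### The test function `g_σ(t) = log t · t^{−σ}` -/

/-- `g_σ(t) = (log t) t^{−σ}` (`= log t/t^σ`), the size of the `n`-th term of `−L′(σ, χ)`.
[cite: Bordignon2020, §2.2 (f(n) = log n/n^σ)] -/
def g (σ : ℝ) (t : ℝ) : ℝ := Real.log t * t ^ (-σ)

/-- `g_σ'(t) = t^{−σ−1}(1 − σ log t)` for `t > 0`. [cite: Bordignon2020, §2.2 p. 5 (f(n) = log n/n^σ, decreasing for n ≥ 4, convex for n ≥ 5)] -/
theorem hasDerivAt_g (σ : ℝ) {t : ℝ} (ht : 0 < t) :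
    HasDerivAt (g σ) (t ^ (-σ - 1) * (1 - σ * Real.log t)) t := by
  have h1 := Real.hasDerivAt_log ht.ne'
  have h2 := Real.hasDerivAt_rpow_const (p := -σ) (x := t) (Or.inl ht.ne')
  have h := h1.mul h2
  have e1 : t ^ (-σ - 1) = t ^ (-σ) / t := Real.rpow_sub_one ht.ne' _
  refine h.congr_deriv ?_
  rw [e1]
  field_simp
  ring

/-- `g_σ''(t) = t^{−σ−2}(σ(σ+1) log t − (2σ+1))` for `t > 0` (derivative of `g_σ'`). [cite: Bordignon2020, §2.2 p. 5 (f(n) = log n/n^σ, decreasing for n ≥ 4, convex for n ≥ 5)] -/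
theorem hasDerivAt_g' (σ : ℝ) {t : ℝ} (ht : 0 < t) :
    HasDerivAt (fun u : ℝ => u ^ (-σ - 1) * (1 - σ * Real.log u))
      (t ^ (-σ - 2) * (σ * (σ + 1) * Real.log t - (2 * σ + 1))) t := by
  have h1 := Real.hasDerivAt_rpow_const (p := -σ - 1) (x := t) (Or.inl ht.ne')
  have h2 : HasDerivAt (fun u : ℝ => 1 - σ * Real.log u) (-(σ * t⁻¹)) t := by
    have := (Real.hasDerivAt_log ht.ne').const_mul σ
    simpa using this.const_sub 1
  have h := h1.mul h2
  have e1 : t ^ (-σ - 2) = t ^ (-σ - 1) / t := by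
    rw [show -σ - 2 = -σ - 1 - 1 by ring]; exact Real.rpow_sub_one ht.ne' _
  have e3 : t ^ (-σ - 1) = t ^ (-σ - 2) * t := by rw [e1]; field_simp
  refine h.congr_deriv ?_
  rw [show -σ - 1 - 1 = -σ - 2 by ring]
  rw [show t ^ (-σ - 1) * -(σ * t⁻¹) = -(σ * t ^ (-σ - 2)) by rw [e3]; field_simp]
  ring

/-- `deriv g_σ = g_σ'` on `(0, ∞)`. [cite: Bordignon2020, §2.2 p. 5 (f(n) = log n/n^σ, decreasing for n ≥ 4, convex for n ≥ 5)] -/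
theorem deriv_g (σ : ℝ) {t : ℝ} (ht : 0 < t) :
    deriv (g σ) t = t ^ (-σ - 1) * (1 - σ * Real.log t) := (hasDerivAt_g σ ht).deriv

/-- `g_σ` is non-increasing on `[4, ∞)` for `0.99 ≤ σ` (`σ log t ≥ 0.99 log 4 > 1`). [cite: Bordignon2020, §2.2 p. 5 (f(n) = log n/n^σ, decreasing for n ≥ 4, convex for n ≥ 5)] -/
theorem antitoneOn_g {σ : ℝ} (hσ : 0.99 ≤ σ) : AntitoneOn (g σ) (Set.Ici 4) := by
  have hlog4 : 1.386 < Real.log 4 := by rw [log_four_eq]; have := Real.log_two_gt_d9; linarith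
  refine antitoneOn_of_deriv_nonpos (convex_Ici 4) ?_ ?_ ?_
  · intro t ht
    exact (hasDerivAt_g σ (by simp at ht; linarith)).continuousAt.continuousWithinAt
  · rw [interior_Ici]
    intro t ht
    exact (hasDerivAt_g σ (by simp at ht; linarith)).differentiableAt.differentiableWithinAt
  · rw [interior_Ici]
    intro t ht
    simp only [Set.mem_Ioi] at ht
    rw [deriv_g σ (by linarith)]
    have hpos : 0 < t ^ (-σ - 1) := Real.rpow_pos_of_pos (by linarith) _
    have hlt : Real.log 4 ≤ Real.log t := Real.log_le_log (by norm_num) ht.le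
    have : 1 ≤ σ * Real.log t := by nlinarith
    nlinarith

/-- `g_σ` is convex on `[5, ∞)` for `0.99 ≤ σ ≤ 1` (`σ(σ+1) log t ≥ 0.99·1.99·log 5 > 3 ≥ 2σ + 1`).
[cite: Bordignon2020, §2.2 p. 5 (f(n) = log n/n^σ, decreasing for n ≥ 4, convex for n ≥ 5)] -/
theorem convexOn_g {σ : ℝ} (hσ : 0.99 ≤ σ) (hσ1 : σ ≤ 1) : ConvexOn ℝ (Set.Ici 5) (g σ) := by
  have hlog5 : 1.6094378 < Real.log 5 := log_five_bounds.1
  have hderiv_eq : ∀ t : ℝ, 0 < t → deriv (g σ) t = t ^ (-σ - 1) * (1 - σ * Real.log t) :=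
    fun t ht => deriv_g σ ht
  have hev : ∀ x : ℝ, 0 < x →
      deriv (g σ) =ᶠ[𝓝 x] fun u : ℝ => u ^ (-σ - 1) * (1 - σ * Real.log u) := by
    intro x hx
    filter_upwards [Ioi_mem_nhds hx] with u hu using hderiv_eq u hu
  refine convexOn_of_deriv2_nonneg (convex_Ici 5) ?_ ?_ ?_ ?_
  · intro t ht
    exact (hasDerivAt_g σ (by simp at ht; linarith)).continuousAt.continuousWithinAt
  · rw [interior_Ici]
    intro t ht
    exact (hasDerivAt_g σ (by simp at ht; linarith)).differentiableAt.differentiableWithinAt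
  · rw [interior_Ici]
    intro t ht
    simp only [Set.mem_Ioi] at ht
    have h := (hasDerivAt_g' σ (by linarith : (0:ℝ) < t)).differentiableAt
    exact (h.congr_of_eventuallyEq (hev t (by linarith))).differentiableWithinAt
  · rw [interior_Ici]
    intro t ht
    simp only [Set.mem_Ioi] at ht
    have ht0 : (0 : ℝ) < t := by linarith
    show 0 ≤ deriv (deriv (g σ)) t
    rw [Filter.EventuallyEq.deriv_eq (hev t ht0), (hasDerivAt_g' σ ht0).deriv]
    have hpos : 0 < t ^ (-σ - 2) := Real.rpow_pos_of_pos ht0 _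
    have hlt : Real.log 5 ≤ Real.log t := Real.log_le_log (by norm_num) ht.le
    have hσσ : 1.9701 ≤ σ * (σ + 1) := by nlinarith
    have h1 : 3 ≤ σ * (σ + 1) * Real.log t := by
      have : (1.9701 : ℝ) * 1.6094378 ≤ σ * (σ + 1) * Real.log t :=
        mul_le_mul hσσ (by linarith) (by norm_num) (by linarith)
      linarith
    have h2 : 0 ≤ σ * (σ + 1) * Real.log t - (2 * σ + 1) := by linarith
    exact mul_nonneg hpos.le h2

/-- Discrete consequences: `g(n+1) ≤ g(n)` for `n ≥ 4`. [cite: Bordignon2020, §2.2 (f decreasing)] -/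
theorem g_succ_le {σ : ℝ} (hσ : 0.99 ≤ σ) {n : ℕ} (hn : 4 ≤ n) : g σ (n + 1 : ℕ) ≤ g σ n := by
  have hn' : (4 : ℝ) ≤ n := by exact_mod_cast hn
  exact antitoneOn_g hσ (show (n : ℝ) ∈ Set.Ici 4 from hn') (show ((n + 1 : ℕ) : ℝ) ∈ Set.Ici 4 by
    simp only [Set.mem_Ici]; push_cast; linarith) (by push_cast; linarith)

/-- `g(n) − 2g(n+1) + g(n+2) ≥ 0` for `n ≥ 5` (convexity). [cite: Bordignon2020, §2.2 (f convex for n ≥ 5)] -/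
theorem secondDiff_g_nonneg_of_five_le {σ : ℝ} (hσ : 0.99 ≤ σ) (hσ1 : σ ≤ 1) {n : ℕ} (hn : 5 ≤ n) :
    0 ≤ g σ n - 2 * g σ (n + 1 : ℕ) + g σ (n + 2 : ℕ) := by
  have hn' : (5 : ℝ) ≤ n := by exact_mod_cast hn
  have hc := convexOn_g hσ hσ1
  have h := hc.2 (show (n : ℝ) ∈ Set.Ici 5 from hn') (show ((n : ℝ) + 2) ∈ Set.Ici 5 by
      simp only [Set.mem_Ici]; linarith)
    (show (0 : ℝ) ≤ 1 / 2 by norm_num) (show (0 : ℝ) ≤ 1 / 2 by norm_num) (by norm_num)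
  simp only [smul_eq_mul] at h
  have e : (1 / 2 : ℝ) * n + 1 / 2 * ((n : ℝ) + 2) = (n : ℝ) + 1 := by ring
  rw [e] at h
  push_cast
  linarith

/-- `g(n) ≥ 0` for `n ≥ 1`. [cite: Bordignon2020, §2.2 p. 5 (f(n) = log n/n^σ, decreasing for n ≥ 4, convex for n ≥ 5)] -/
theorem g_nonneg (σ : ℝ) {n : ℕ} (hn : 1 ≤ n) : 0 ≤ g σ n := by
  unfold g
  exact mul_nonneg (Real.log_nonneg (by exact_mod_cast hn)) (Real.rpow_nonneg (Nat.cast_nonneg n) _)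

/-- `g(0) = 0` (`log 0 = 0`). [cite: Bordignon2020, §2.2 p. 5 (f(n) = log n/n^σ, decreasing for n ≥ 4, convex for n ≥ 5)] -/
@[simp] theorem g_zero (σ : ℝ) : g σ 0 = 0 := by simp [g]

/-- `g(1) = 0`. [cite: Bordignon2020, §2.2 p. 5 (f(n) = log n/n^σ, decreasing for n ≥ 4, convex for n ≥ 5)] -/
@[simp] theorem g_one (σ : ℝ) : g σ 1 = 0 := by simp [g]

/-- `g_σ(n) → 0` (for `σ > 0`). [cite: Bordignon2020, §2.2 p. 5 (f(n) = log n/n^σ, decreasing for n ≥ 4, convex for n ≥ 5)] -/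
theorem tendsto_g {σ : ℝ} (hσ : 0 < σ) : Tendsto (fun n : ℕ => g σ n) atTop (𝓝 0) := by
  have h := (isLittleO_log_rpow_atTop hσ).tendsto_div_nhds_zero
  have h2 := h.comp tendsto_natCast_atTop_atTop
  refine h2.congr' ?_
  filter_upwards [eventually_ge_atTop 1] with n hn
  simp only [Function.comp, g]
  rw [Real.rpow_neg (Nat.cast_nonneg n), div_eq_mul_inv]

/-- `g_σ(n) = (log n/n)·n^{1−σ}` for `n ≥ 1`. [cite: Bordignon2020, §2.2 p. 5 (f(n) = log n/n^σ, decreasing for n ≥ 4, convex for n ≥ 5)] -/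
theorem g_eq_mul_rpow (σ : ℝ) {t : ℝ} (ht : 0 < t) : g σ t = Real.log t / t * t ^ (1 - σ) := by
  unfold g
  rw [show (1 : ℝ) - σ = -σ + 1 by ring, Real.rpow_add ht, Real.rpow_one]
  field_simp

/-- The one second difference below the convexity range: **`g(4) − 2g(5) + g(6) ≥ 0` for
`1 − 0.0011 ≤ σ ≤ 1`** (numerically `≥ 2·10⁻⁴`; uses `log 2`, `log 3`, `log 5` to 7 places and
`5^{1−σ} ≤ 1.001774`). [cite: Bordignon2020, §2.2 («f(4) − 2f(4+1) + f(4+2) ≥ 0»)] -/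
theorem secondDiff_g_four_nonneg {σ : ℝ} (hσ : 1 - 0.0011 ≤ σ) (hσ1 : σ ≤ 1) :
    0 ≤ g σ (4 : ℕ) - 2 * g σ (5 : ℕ) + g σ (6 : ℕ) := by
  have hl2 := Real.log_two_gt_d9
  have hl2' := Real.log_two_lt_d9
  have hl3 := log_three_gt
  obtain ⟨hl5, hl5'⟩ := log_five_bounds
  -- lower bounds `g(4) ≥ log 4/4`, `g(6) ≥ log 6/6`
  have hlow : ∀ m : ℕ, 1 ≤ m → Real.log m / m ≤ g σ m := by
    intro m hm
    have hm' : (1 : ℝ) ≤ m := by exact_mod_cast hm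
    unfold g
    rw [div_eq_mul_inv, ← Real.rpow_neg_one]
    exact mul_le_mul_of_nonneg_left (Real.rpow_le_rpow_of_exponent_le hm' (by linarith))
      (Real.log_nonneg hm')
  have h4 := hlow 4 (by norm_num)
  have h6 := hlow 6 (by norm_num)
  -- upper bound `g(5) = (log 5/5) 5^{1−σ} ≤ (log 5/5)·1.001774`
  have h5 : g σ (5 : ℕ) ≤ Real.log 5 / 5 * 1.001774 := by
    push_cast
    rw [g_eq_mul_rpow σ (by norm_num : (0:ℝ) < 5)]
    refine mul_le_mul_of_nonneg_left ?_ (div_nonneg (by linarith) (by norm_num))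
    rw [Real.rpow_def_of_pos (by norm_num : (0:ℝ) < 5)]
    have hu : Real.log 5 * (1 - σ) ≤ 0.00178 := by nlinarith
    have hu0 : 0 ≤ Real.log 5 * (1 - σ) := by nlinarith
    have := exp_le_one_add_add_sq (y := Real.log 5 * (1 - σ)) (by rw [abs_of_nonneg hu0]; linarith)
    nlinarith
  push_cast at h4 h5 h6 ⊢
  rw [log_four_eq] at h4
  rw [log_six_eq] at h6
  nlinarith

/-! ### `−L′(σ, χ) = lim_N ∑_{n ≤ N} χ(n) (log n) n^{−σ}` for `σ > 0`, `χ ≠ χ₀` -/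

section Series

variable {q : ℕ} [NeZero q] (χ : DirichletCharacter ℂ q)

/-- For real `σ` and `m ≥ 1`: `m^{−σ} log m` (complex powers) `= g_σ(m)`. [folklore] -/
private theorem cpow_mul_log_eq_g (σ : ℝ) (m : ℕ) :
    ((m : ℕ) : ℂ) ^ (-(σ : ℂ)) * Complex.log ((m : ℕ) : ℂ) = ((g σ m : ℝ) : ℂ) := by
  unfold g
  have hm : (0 : ℝ) ≤ (m : ℝ) := Nat.cast_nonneg m
  rw [show ((m : ℕ) : ℂ) = ((m : ℝ) : ℂ) by push_cast; rfl, ← Complex.ofReal_log hm,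
    show (-(σ : ℂ)) = ((-σ : ℝ) : ℂ) by push_cast; rfl, ← Complex.ofReal_cpow hm]
  push_cast
  ring

omit [NeZero q] in
/-- The derivative of the `n`-th Abel term at real `σ`: `−S(n+1)(g(n+1) − g(n+2))`. [folklore] -/
private theorem deriv_term_ofReal (σ : ℝ) (n : ℕ) :
    deriv (DirichletAbel.term χ n) (σ : ℂ) =
      -(DirichletAbel.partialSum χ (n + 1) * (((g σ (n + 1 : ℕ) - g σ (n + 2 : ℕ) : ℝ) : ℂ))) := by
  rw [DirichletAbel.deriv_term, cpow_mul_log_eq_g, show n + 1 + 1 = n + 2 by ring, cpow_mul_log_eq_g]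
  push_cast
  ring

omit [NeZero q] in
/-- **Abel summation (finite):** `∑_{m ≤ N} g(m)χ(m) = ∑_{n<N} S(n+1)(g(n+1) − g(n+2)) + S(N) g(N+1)`
(`g(0) = g(1)·χ… `; here `g(0) = 0`). [cite: MontgomeryVaughan2007, §1.3 Thm. 1.3] -/
theorem sum_g_mul_apply_eq (σ : ℝ) (N : ℕ) :
    ∑ m ∈ range (N + 1), ((g σ m : ℝ) : ℂ) * χ (m : ZMod q) =
      (∑ n ∈ range N, DirichletAbel.partialSum χ (n + 1) * (((g σ (n + 1 : ℕ) - g σ (n + 2 : ℕ) : ℝ) : ℂ))) +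
        DirichletAbel.partialSum χ N * ((g σ (N + 1 : ℕ) : ℝ) : ℂ) := by
  induction N with
  | zero => simp
  | succ N ih =>
    rw [sum_range_succ, ih, sum_range_succ, DirichletAbel.partialSum_succ χ N,
      show N + 1 + 1 = N + 2 by ring]
    push_cast
    ring

/-- **`∑_{m ≤ N} χ(m) g_σ(m) → −L′(σ, χ)`** as `N → ∞`, for real `σ > 0` and `χ ≠ χ₀`: the tree's
`L′(s,χ) = ∑_n d/ds[S(n+1)((n+1)^{−s} − (n+2)^{−s})]` (`DirichletAbel.deriv_LFunction_eq_tsum`) plus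
`S(N) g(N+1) → 0` (`|S(N)| ≤ q`). [cite: MontgomeryVaughan2007, §4.3 Thm. 4.8 and eq. (4.33)] -/
theorem tendsto_sum_g_mul_apply (hχ : χ ≠ 1) {σ : ℝ} (hσ : 0 < σ) :
    Tendsto (fun N : ℕ => ∑ m ∈ range (N + 1), ((g σ m : ℝ) : ℂ) * χ (m : ZMod q)) atTop
      (𝓝 (-deriv χ.LFunction (σ : ℂ))) := by
  have hs : 0 < ((σ : ℂ)).re := by simpa using hσ
  have hsum := DirichletAbel.summable_deriv_term χ hχ hs
  have hL := DirichletAbel.deriv_LFunction_eq_tsum χ hχ hs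
  have h1 : Tendsto (fun N : ℕ => ∑ n ∈ range N, deriv (DirichletAbel.term χ n) (σ : ℂ)) atTop
      (𝓝 (deriv χ.LFunction (σ : ℂ))) := by
    rw [hL]; exact hsum.hasSum.tendsto_sum_nat
  -- the boundary term `S(N) g(N+1) → 0`
  have h2 : Tendsto (fun N : ℕ => DirichletAbel.partialSum χ N * ((g σ (N + 1 : ℕ) : ℝ) : ℂ)) atTop (𝓝 0) := by
    have hg : Tendsto (fun N : ℕ => ((g σ (N + 1 : ℕ) : ℝ) : ℂ)) atTop (𝓝 0) := by
      have := (tendsto_g hσ).comp (tendsto_add_atTop_nat 1)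
      have h0 : Tendsto (fun N : ℕ => ((g σ (N + 1 : ℕ) : ℝ) : ℂ)) atTop (𝓝 ((0 : ℝ) : ℂ)) :=
        (Complex.continuous_ofReal.tendsto 0).comp this
      simpa using h0
    have hbdd : ∀ N : ℕ, ‖DirichletAbel.partialSum χ N‖ ≤ q := fun N => DirichletAbel.norm_partialSum_le χ hχ N
    rw [tendsto_zero_iff_norm_tendsto_zero]
    have hg' : Tendsto (fun N : ℕ => (q : ℝ) * ‖((g σ (N + 1 : ℕ) : ℝ) : ℂ)‖) atTop (𝓝 ((q : ℝ) * 0)) :=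
      (tendsto_zero_iff_norm_tendsto_zero.mp hg).const_mul _
    rw [mul_zero] at hg'
    refine squeeze_zero (fun N => norm_nonneg _) (fun N => ?_) hg'
    rw [norm_mul]
    exact mul_le_mul_of_nonneg_right (hbdd N) (norm_nonneg _)
  have h3 : ∀ N : ℕ, ∑ m ∈ range (N + 1), ((g σ m : ℝ) : ℂ) * χ (m : ZMod q) =
      -(∑ n ∈ range N, deriv (DirichletAbel.term χ n) (σ : ℂ)) +
        DirichletAbel.partialSum χ N * ((g σ (N + 1 : ℕ) : ℝ) : ℂ) := by
    intro N
    rw [sum_g_mul_apply_eq, ← sum_neg_distrib]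
    congr 1
    exact sum_congr rfl fun n _ => by rw [deriv_term_ofReal]; ring
  simp_rw [h3]
  have := h1.neg.add h2
  simpa using this

/-- The partial sums from `n = 4`: `∑_{4 ≤ n < M+6} χ(n) g(n) → −L′(σ,χ) − χ(2)g(2) − χ(3)g(3)`
(`g(0) = g(1) = 0`). [cite: Bordignon2020, §2.2] -/
theorem tendsto_sum_Ico_four_g_mul_apply (hχ : χ ≠ 1) {σ : ℝ} (hσ : 0 < σ) :
    Tendsto (fun M : ℕ => ∑ n ∈ Ico 4 (M + 6), ((g σ n : ℝ) : ℂ) * χ (n : ZMod q)) atTop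
      (𝓝 (-deriv χ.LFunction (σ : ℂ) - (((g σ (2 : ℕ) : ℝ) : ℂ) * χ (2 : ZMod q) +
        ((g σ (3 : ℕ) : ℝ) : ℂ) * χ (3 : ZMod q)))) := by
  have h := (tendsto_sum_g_mul_apply χ hχ hσ).comp (tendsto_add_atTop_nat 5)
  have hsplit : ∀ M : ℕ, ∑ n ∈ Ico 4 (M + 6), ((g σ n : ℝ) : ℂ) * χ (n : ZMod q) =
      (∑ m ∈ range (M + 5 + 1), ((g σ m : ℝ) : ℂ) * χ (m : ZMod q)) -
        (((g σ (2 : ℕ) : ℝ) : ℂ) * χ (2 : ZMod q) + ((g σ (3 : ℕ) : ℝ) : ℂ) * χ (3 : ZMod q)) := by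
    intro M
    rw [show M + 5 + 1 = M + 6 by ring, Finset.range_eq_Ico,
      ← Finset.sum_Ico_consecutive _ (show 0 ≤ 4 by norm_num) (show 4 ≤ M + 6 by omega)]
    have h4 : ∑ m ∈ Ico (0 : ℕ) 4, ((g σ m : ℝ) : ℂ) * χ (m : ZMod q) =
        ((g σ (2 : ℕ) : ℝ) : ℂ) * χ (2 : ZMod q) + ((g σ (3 : ℕ) : ℝ) : ℂ) * χ (3 : ZMod q) := by
      rw [show (Ico (0 : ℕ) 4 : Finset ℕ) = {0, 1, 2, 3} by decide]
      simp [Finset.sum_insert]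
    rw [h4]
    push_cast
    ring
  simp_rw [hsplit]
  exact h.sub_const _

end Series

/-! ### Real-variable inputs of the final estimate -/

/-- `∫_3^A (log x)/x dx = (log² A − log² 3)/2` for `A ≥ 3`. [folklore] -/
private theorem integral_log_div (A : ℝ) (hA : 3 ≤ A) :
    ∫ x in (3 : ℝ)..A, Real.log x / x = Real.log A ^ 2 / 2 - Real.log 3 ^ 2 / 2 := by
  have hderiv : ∀ x ∈ Set.uIcc (3 : ℝ) A, HasDerivAt (fun x => Real.log x ^ 2 / 2) (Real.log x / x) x := by
    intro x hx
    rw [Set.uIcc_of_le hA] at hx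
    have hx0 : x ≠ 0 := by linarith [hx.1]
    have h := ((Real.hasDerivAt_log hx0).pow 2).div_const 2
    refine h.congr_deriv ?_
    simp; field_simp
  have hcont : ContinuousOn (fun x => Real.log x / x) (Set.uIcc (3 : ℝ) A) := by
    rw [Set.uIcc_of_le hA]
    refine ContinuousOn.div (Real.continuousOn_log.mono ?_) continuousOn_id ?_
    · intro x hx; simp; linarith [hx.1]
    · intro x hx; simp at hx ⊢; linarith [hx.1]
  rw [intervalIntegral.integral_eq_sub_of_hasDerivAt hderiv (hcont.intervalIntegrable)]

/-- **`∑_{2 ≤ m ≤ A} (log m)/m ≤ ½ log² A + 0.11`** for `A ≥ 4` (`(log x)/x` decreases on `[e, ∞)`: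
`∑_{m=4}^{A} ≤ ∫_3^A = ½log²A − ½log²3`, and `log2/2 + log3/3 − ½log²3 < 0.11`).
[cite: Bordignon2020, §2.2 («∑_1^A log n/n ≤ ½log²A − ½log²d + ∑_2^d log n/n»)] -/
theorem sum_log_div_le {A : ℕ} (hA : 4 ≤ A) :
    ∑ m ∈ Ico 2 (A + 1), Real.log m / m ≤ Real.log A ^ 2 / 2 + 0.11 := by
  have hA3 : (3 : ℝ) ≤ A := by exact_mod_cast (show 3 ≤ A by omega)
  -- split off `m = 2, 3`
  rw [Finset.sum_eq_sum_Ico_succ_bot (show 2 < A + 1 by omega),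
    Finset.sum_eq_sum_Ico_succ_bot (show 3 < A + 1 by omega)]
  -- the rest against the integral
  have hanti : AntitoneOn (fun x : ℝ => Real.log x / x) (Set.Icc (3 : ℝ) A) := by
    refine Real.log_div_self_antitoneOn.mono fun x hx => ?_
    simp only [Set.mem_Ici]
    have := Real.exp_one_lt_d9
    linarith [hx.1]
  have hsum := AntitoneOn.sum_le_integral_Ico (f := fun x : ℝ => Real.log x / x) (show 3 ≤ A by omega) hanti
  push_cast at hsum
  rw [integral_log_div A hA3] at hsum
  rw [← Finset.sum_Ico_add' (f := fun m : ℕ => Real.log (m : ℝ) / (m : ℝ)) 3 A 1]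
  push_cast
  have hl2 := Real.log_two_lt_d9
  have hl3 := log_three_gt
  have hl3' : Real.log 3 < 1.0986124 := by
    have h := Real.abs_log_sub_add_sum_range_le (x := (1 / 3 : ℝ)) (by rw [abs_of_pos (by norm_num)]; norm_num) 14
    rw [abs_of_pos (by norm_num : (0 : ℝ) < 1 / 3)] at h
    have hs : ∑ i ∈ range 14, (1 / 3 : ℝ) ^ (i + 1) / (i + 1) = 11092950499 / 27358582680 := by
      simp only [sum_range_succ, sum_range_zero]
      norm_num
    rw [hs, show (1 : ℝ) - 1 / 3 = 2 / 3 by norm_num, Real.log_div (by norm_num) (by norm_num)] at h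
    have h' := (abs_le.1 h).1
    norm_num at h'
    linarith
  nlinarith [mul_nonneg (sub_nonneg.2 hl3.le) (by linarith : (0:ℝ) ≤ Real.log 3 + 1.0986121 - 2 / 3)]

/-- **`log q ≤ √q/16` for `q ≥ 5⁸ = 390 625`** (`u = q^{1/8} ≥ 5`: `log q = 8 log u ≤ 8(u − 1) ≤ u⁴/16`).
[folklore] -/
private theorem log_le_sqrt_div {x : ℝ} (hx : 390625 ≤ x) : Real.log x ≤ Real.sqrt x / 16 := by
  have hx0 : 0 < x := by linarith
  set u : ℝ := x ^ ((1 : ℝ) / 8) with hu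
  have hu0 : 0 < u := Real.rpow_pos_of_pos hx0 _
  have hu8 : u ^ (8 : ℕ) = x := by
    rw [hu, ← Real.rpow_natCast, ← Real.rpow_mul hx0.le]; norm_num
  have hu4 : u ^ (4 : ℕ) = Real.sqrt x := by
    rw [hu, ← Real.rpow_natCast, ← Real.rpow_mul hx0.le, Real.sqrt_eq_rpow]; norm_num
  have hu5 : 5 ≤ u := by
    by_contra hlt
    rw [not_le] at hlt
    have : u ^ (8 : ℕ) < 5 ^ (8 : ℕ) := pow_lt_pow_left₀ hlt hu0.le (by norm_num)
    rw [hu8] at this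
    norm_num at this
    linarith
  have hlog : Real.log x = 8 * Real.log u := by
    rw [← hu8, Real.log_pow]; push_cast; ring
  have hlu : Real.log u ≤ u - 1 := Real.log_le_sub_one_of_pos hu0
  rw [hlog, ← hu4]
  have key : 0 ≤ u ^ 4 - 128 * u + 128 := by
    nlinarith [mul_nonneg (sub_nonneg.2 hu5) (by nlinarith : (0:ℝ) ≤ u ^ 3 + 5 * u ^ 2 + 25 * u - 3)]
  nlinarith

variable {q : ℕ} [NeZero q] (χ : DirichletCharacter ℂ q)

/-- `t ↦ t·g_σ(t) = (log t)·t^{1−σ}` is non-decreasing on `[1, ∞)` for `σ ≤ 1`: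
`(A+1)g(A+1) ≤ (A+2)g(A+2)`. [folklore] -/
private theorem succ_mul_g_le {σ : ℝ} (hσ1 : σ ≤ 1) {t : ℝ} (ht : 1 ≤ t) :
    t * g σ t ≤ (t + 1) * g σ (t + 1) := by
  have ht0 : 0 < t := by linarith
  have e : ∀ u : ℝ, 0 < u → u * g σ u = Real.log u * u ^ (1 - σ) := by
    intro u hu
    rw [g_eq_mul_rpow σ hu]; field_simp
  rw [e t ht0, e (t + 1) (by linarith)]
  have h1 : Real.log t ≤ Real.log (t + 1) := Real.log_le_log ht0 (by linarith)
  have h2 : t ^ (1 - σ) ≤ (t + 1) ^ (1 - σ) := Real.rpow_le_rpow ht0.le (by linarith) (by linarith)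
  have h3 : 0 ≤ Real.log t := Real.log_nonneg ht
  have h4 : 0 ≤ t ^ (1 - σ) := Real.rpow_nonneg ht0.le _
  exact mul_le_mul h1 h2 h4 (by linarith)

/-- Lower bound `g_σ(t) ≥ (log t)/t` for `t ≥ 1`, `σ ≤ 1`. [folklore] -/
private theorem log_div_le_g {σ : ℝ} (hσ1 : σ ≤ 1) {t : ℝ} (ht : 1 ≤ t) : Real.log t / t ≤ g σ t := by
  unfold g
  rw [div_eq_mul_inv, ← Real.rpow_neg_one]
  exact mul_le_mul_of_nonneg_left (Real.rpow_le_rpow_of_exponent_le ht (by linarith)) (Real.log_nonneg ht)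

/-- Upper bound `g_σ(m) ≤ (log m/m)·M^{1−σ}` for `1 ≤ m ≤ M`, `σ ≤ 1`. [folklore] -/
private theorem g_le_log_div_mul {σ : ℝ} (hσ1 : σ ≤ 1) {m M : ℝ} (hm : 1 ≤ m) (hmM : m ≤ M) :
    g σ m ≤ Real.log m / m * M ^ (1 - σ) := by
  rw [g_eq_mul_rpow σ (by linarith)]
  exact mul_le_mul_of_nonneg_left (Real.rpow_le_rpow (by linarith) hmM (by linarith))
    (div_nonneg (Real.log_nonneg hm) (by linarith))

/-- `18 g(4) − 12 g(5) ≤ 2.385` for `0 ≤ 1 − σ ≤ 0.0010127`. [cite: Bordignon2020, §2.2 (R(A,σ))] -/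
private theorem bound_small_terms {σ : ℝ} (hδ0 : 0 ≤ 1 - σ) (hδ1 : 1 - σ ≤ 0.0010127) :
    18 * g σ (4 : ℕ) - 12 * g σ (5 : ℕ) ≤ 2.385 := by
  have hσ1 : σ ≤ 1 := by linarith
  have hl2 := Real.log_two_lt_d9
  have hl2' := Real.log_two_gt_d9
  obtain ⟨hl5, -⟩ := log_five_bounds
  have hf5 : Real.log 5 / 5 ≤ g σ (5 : ℕ) := by
    have := log_div_le_g hσ1 (t := 5) (by norm_num)
    simpa using this
  have hexp : Real.exp (2 * Real.log 2 * (1 - σ)) ≤ 1.001406 := by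
    have hu : 2 * Real.log 2 * (1 - σ) ≤ 0.001404 := by nlinarith
    have hu0 : 0 ≤ 2 * Real.log 2 * (1 - σ) := by nlinarith
    have := exp_le_one_add_add_sq (y := 2 * Real.log 2 * (1 - σ)) (by rw [abs_of_nonneg hu0]; linarith)
    nlinarith
  have hf4 : g σ (4 : ℕ) ≤ 2 * Real.log 2 / 4 * 1.001406 := by
    push_cast
    rw [g_eq_mul_rpow σ (by norm_num : (0:ℝ) < 4), Real.rpow_def_of_pos (by norm_num : (0:ℝ) < 4),
      log_four_eq]
    exact mul_le_mul_of_nonneg_left hexp (by positivity)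
  push_cast at hf5
  nlinarith

/-- `−((A−3)/2)·g(A+1) ≤ −3.198` for `A ≥ 631`, `σ ≤ 1` (`g(A+1) ≥ log(A+1)/(A+1)`, `log 632 ≥ 4 log 5`).
[cite: Bordignon2020, §2.2 (R(A,σ))] -/
private theorem bound_negative_term {σ : ℝ} (hσ1 : σ ≤ 1) {A : ℕ} (hA : 631 ≤ A) :
    -(((A : ℝ) - 3) / 2) * g σ ((A + 1 : ℕ) : ℝ) ≤ -3.198 := by
  have hA' : (631 : ℝ) ≤ A := by exact_mod_cast hA
  have hlow : Real.log ((A : ℝ) + 1) / ((A : ℝ) + 1) ≤ g σ ((A + 1 : ℕ) : ℝ) := by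
    have := log_div_le_g hσ1 (t := (A : ℝ) + 1) (by linarith)
    push_cast
    exact this
  have hlogB : 6.4377 ≤ Real.log ((A : ℝ) + 1) := by
    have h5 : Real.log 625 = 4 * Real.log 5 := by
      rw [show (625 : ℝ) = 5 ^ 4 by norm_num, Real.log_pow]; push_cast; ring
    have h625 : Real.log 625 ≤ Real.log ((A : ℝ) + 1) := Real.log_le_log (by norm_num) (by linarith)
    have := log_five_bounds.1
    linarith
  have hcoef : (0.4968 : ℝ) ≤ ((A : ℝ) - 3) / (2 * ((A : ℝ) + 1)) := by
    rw [le_div_iff₀ (by positivity)]; linarith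
  have hprod : 0.4968 * 6.4377 ≤ ((A : ℝ) - 3) / (2 * ((A : ℝ) + 1)) * Real.log ((A : ℝ) + 1) :=
    mul_le_mul hcoef hlogB (by norm_num) (by linarith)
  have e : ((A : ℝ) - 3) / 2 * (Real.log ((A : ℝ) + 1) / ((A : ℝ) + 1)) =
      ((A : ℝ) - 3) / (2 * ((A : ℝ) + 1)) * Real.log ((A : ℝ) + 1) := by
    field_simp
  have hA3 : 0 ≤ ((A : ℝ) - 3) / 2 := by linarith
  have := mul_le_mul_of_nonneg_left hlow hA3
  nlinarith

/-- The head-sum numerics: `X(ℓ²/2 + 0.11) ≤ L²/8 + 0.504` when `0 ≤ X ≤ 1 + y + y²`, `0 ≤ y ≤ 0.0064`,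
`y L² ≤ 3.125`, `0 ≤ ℓ ≤ L/2`. [cite: Bordignon2020, §2.2 ((9))] -/
private theorem bound_head {X y ℓ L : ℝ} (hX0 : 0 ≤ X) (hX : X ≤ 1 + y + y ^ 2) (hy0 : 0 ≤ y)
    (hy1 : y ≤ 0.0064) (hyL : y * L ^ 2 ≤ 3.125) (hℓ0 : 0 ≤ ℓ) (hℓ : ℓ ≤ L / 2) :
    X * (ℓ ^ 2 / 2 + 0.11) ≤ 1 / 8 * L ^ 2 + 0.504 := by
  have h1 : ℓ ^ 2 / 2 ≤ 1 / 8 * L ^ 2 := by nlinarith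
  have h2 : X * (ℓ ^ 2 / 2 + 0.11) ≤ (1 + y + y ^ 2) * (1 / 8 * L ^ 2 + 0.11) :=
    mul_le_mul hX (by linarith) (by positivity) (by positivity)
  have h3 : y ^ 2 * L ^ 2 ≤ 0.0064 * 3.125 := by
    have : y ^ 2 * L ^ 2 = y * (y * L ^ 2) := by ring
    rw [this]; exact mul_le_mul hy1 hyL (by positivity) (by norm_num)
  nlinarith

/-- The analytic half of Theorem 1.1: for `χ` primitive real even mod `q > 1`, `σ ∈ [1 − 0.0011, 1]`,
`σ ≥ 0.99`, and any `A ≥ 5`, `‖L′(σ,χ)‖ ≤ g(2) + g(3) + [Theorem 2.1's bound for f = g_σ]`.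
[cite: Bordignon2020, Theorem 1.1 (proof, (9))] -/
theorem norm_deriv_LFunction_le_secondOrder (hq1 : 1 < q) (hprim : χ.IsPrimitive) (hquad : χ.IsQuadratic)
    (heven : χ.Even) {σ : ℝ} (hσ99 : 0.99 ≤ σ) (hσlo : 1 - 0.0011 ≤ σ) (hσ1 : σ ≤ 1) {A : ℕ} (hA : 5 ≤ A) :
    ‖deriv χ.LFunction (σ : ℂ)‖ ≤
      ((∑ m ∈ Ico 6 (A + 1), g σ m) + 10 * g σ (4 : ℕ) - 5 * g σ (5 : ℕ) -
          ((A : ℝ) * (A + 3) / 2) * g σ ((A + 1 : ℕ) : ℝ) + ((A : ℝ) * (A + 1) / 2) * g σ ((A + 2 : ℕ) : ℝ)) +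
        Real.sqrt q / 2 * (((A : ℝ) + 1) * g σ ((A + 1 : ℕ) : ℝ) - (A : ℝ) * g σ ((A + 2 : ℕ) : ℝ)) +
        (9 * g σ (4 : ℕ) - 6 * g σ (5 : ℕ)) + g σ (2 : ℕ) + g σ (3 : ℕ) := by
  have hσpos : 0 < σ := by linarith
  have hχ1 : χ ≠ 1 := by
    intro h1
    rw [DirichletCharacter.isPrimitive_def, h1, DirichletCharacter.conductor_one] at hprim
    omega
  have hf0 : ∀ n, 4 ≤ n → 0 ≤ (fun n : ℕ => g σ n) n := fun n hn => g_nonneg σ (by omega)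
  have hmono : ∀ n, 4 ≤ n → (fun n : ℕ => g σ n) (n + 1) ≤ (fun n : ℕ => g σ n) n :=
    fun n hn => g_succ_le hσ99 hn
  have hconv : ∀ n, 4 ≤ n → 0 ≤ DirichletAbel.secondDiff (fun n : ℕ => g σ n) n := by
    intro n hn
    unfold DirichletAbel.secondDiff
    rcases Nat.lt_or_ge n 5 with h5 | h5
    · have hn4 : n = 4 := by omega
      rw [hn4]
      exact secondDiff_g_four_nonneg hσlo hσ1
    · exact secondDiff_g_nonneg_of_five_le hσ99 hσ1 h5
  have hΛ := tendsto_sum_Ico_four_g_mul_apply χ hχ1 hσpos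
  have hbound := DirichletAbel.norm_lim_le_secondOrder χ hq1 hprim hquad heven (fun n : ℕ => g σ n) hf0 hmono
    hconv (tendsto_g hσpos) hA hΛ
  have hg2 : 0 ≤ g σ (2 : ℕ) := g_nonneg σ (by norm_num)
  have hg3 : 0 ≤ g σ (3 : ℕ) := g_nonneg σ (by norm_num)
  set D : ℂ := deriv χ.LFunction (σ : ℂ)
  set T : ℂ := ((g σ (2 : ℕ) : ℝ) : ℂ) * χ (2 : ZMod q) + ((g σ (3 : ℕ) : ℝ) : ℂ) * χ (3 : ZMod q)
  have h2 : ‖((g σ (2 : ℕ) : ℝ) : ℂ) * χ (2 : ZMod q)‖ ≤ g σ (2 : ℕ) := by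
    rw [norm_mul, Complex.norm_real, Real.norm_eq_abs, abs_of_nonneg hg2]
    exact mul_le_of_le_one_right hg2 (DirichletCharacter.norm_le_one _ _)
  have h3 : ‖((g σ (3 : ℕ) : ℝ) : ℂ) * χ (3 : ZMod q)‖ ≤ g σ (3 : ℕ) := by
    rw [norm_mul, Complex.norm_real, Real.norm_eq_abs, abs_of_nonneg hg3]
    exact mul_le_of_le_one_right hg3 (DirichletCharacter.norm_le_one _ _)
  have hT : ‖T‖ ≤ g σ (2 : ℕ) + g σ (3 : ℕ) := (norm_add_le _ _).trans (add_le_add h2 h3)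
  have e : D = -(-D - T) - T := by ring
  have hstep : ‖D‖ ≤ ‖-D - T‖ + ‖T‖ := by
    calc ‖D‖ = ‖-(-D - T) - T‖ := by rw [← e]
      _ ≤ ‖-(-D - T)‖ + ‖T‖ := norm_sub_le _ _
      _ = ‖-D - T‖ + ‖T‖ := by rw [norm_neg]
  refine hstep.trans ((add_le_add hbound hT).trans (le_of_eq ?_))
  ring

set_option maxHeartbeats 400000 in
/-- **Bordignon, J. Number Theory 210 (2020), Theorem 1.1 — PROVED:** «Assume `χ` is an even primitive
real character and `σ ∈ (β₀, 1)`. With `β₀ ⩾ 1 − 100/(√q log²q)` and `q > 4·10⁵`, the following bound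
holds `|L′(σ,χ)| ⩽ ⅛ log²q`.» Typed with `σ` ranging over the closed window
`[1 − 100/(√q log²q), 1]` (the printed `β₀` only parametrises the window). Proof as in print (§2.2):
Theorem 2.1 applied to `f(n) = log n/n^σ` (`A = ⌊√q⌋ − 1`), `∑_{n ≤ A} log n/n^σ ≤
q^{(1−σ)/2}(½log²A + 0.11)`, `q^{(1−σ)/2} ≤ e^{50/(√q log q)}`, and the elementary estimate of the
remaining terms `R(A,σ) ≤ 18f(4) − 12f(5) − ((A−3)/2)f(A+1) ≤ 2.39 − 3.19`; margin `≈ 0.3` at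
`q = 4·10⁵ + 1`, growing with `q`. [cite: Bordignon2020, Theorem 1.1] -/
theorem bordignon2020_theorem11 (hq : 400000 < q) (hprim : χ.IsPrimitive) (hquad : χ.IsQuadratic)
    (heven : χ.Even) {σ : ℝ} (hσ : 1 - 100 / (Real.sqrt q * Real.log q ^ 2) ≤ σ) (hσ1 : σ ≤ 1) :
    ‖deriv χ.LFunction (σ : ℂ)‖ ≤ 1 / 8 * Real.log q ^ 2 := by
  -- elementary ranges
  have hq1 : 1 < q := by omega
  have hL := Bordignon.log_ge hq          -- 12.5 ≤ log q
  have hR := Bordignon.sqrt_ge hq         -- 632 ≤ √q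
  have hLR : Real.log (q : ℝ) ≤ Real.sqrt (q : ℝ) / 16 :=
    log_le_sqrt_div (by exact_mod_cast (show 390625 ≤ q by omega))
  have hlogsqrt : Real.log (Real.sqrt (q : ℝ)) = Real.log (q : ℝ) / 2 := Real.log_sqrt (Nat.cast_nonneg q)
  -- `A = ⌊√q⌋ − 1`
  obtain ⟨A, hA631, hAR, hRA⟩ : ∃ A : ℕ, 631 ≤ A ∧ ((A : ℝ) + 1) ≤ Real.sqrt q ∧ Real.sqrt q < (A : ℝ) + 2 := by
    have h632 : 632 ≤ Nat.sqrt q := by rw [Nat.le_sqrt]; omega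
    have e : (((Nat.sqrt q - 1 : ℕ) : ℝ) + 1) = ((Nat.sqrt q : ℕ) : ℝ) := by
      rw [Nat.cast_sub (by omega)]; push_cast; ring
    refine ⟨Nat.sqrt q - 1, by omega, ?_, ?_⟩
    · have h1 : ((Nat.sqrt q : ℕ) : ℝ) ≤ Real.sqrt q := Real.nat_sqrt_le_real_sqrt
      linarith
    · have h1 : Real.sqrt q < ((Nat.sqrt q : ℕ) : ℝ) + 1 := Real.real_sqrt_lt_nat_sqrt_succ
      linarith
  have hA' : (631 : ℝ) ≤ A := by exact_mod_cast hA631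
  -- from here on `log q` and `√q` are just real numbers `L`, `R`
  generalize hLdef : Real.log (q : ℝ) = L at *
  generalize hRdef : Real.sqrt (q : ℝ) = R at *
  have hL0 : 0 < L := by linarith
  have hR0 : 0 < R := by linarith
  have hRL2 : 98750 ≤ R * L ^ 2 := by nlinarith
  have hδ : 1 - σ ≤ 100 / (R * L ^ 2) := by linarith
  have hδ1 : 1 - σ ≤ 0.0010127 := by
    have : 100 / (R * L ^ 2) ≤ 0.0010127 := by
      rw [div_le_iff₀ (by positivity)]; nlinarith
    linarith
  have hδ0 : 0 ≤ 1 - σ := by linarith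
  have hσ99 : 0.99 ≤ σ := by linarith
  -- the analytic bound
  have hmain := norm_deriv_LFunction_le_secondOrder χ hq1 hprim hquad heven hσ99 (by linarith) hσ1
    (show 5 ≤ A by omega)
  rw [hRdef] at hmain
  set f : ℕ → ℝ := fun n => g σ n with hfdef
  have hf0 : ∀ n, 4 ≤ n → 0 ≤ f n := fun n hn => g_nonneg σ (by omega)
  have hmono : ∀ n, 4 ≤ n → f (n + 1) ≤ f n := fun n hn => g_succ_le hσ99 hn
  -- (I) the `A`-boundary terms: `√q = A + 1 + θ`, `0 ≤ θ < 1`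
  have hθ0 : 0 ≤ R - ((A : ℝ) + 1) := by linarith
  have hθ1 : R - ((A : ℝ) + 1) ≤ 1 := by linarith
  have hgA1 : 0 ≤ f (A + 1) := hf0 (A + 1) (by omega)
  have hgA2 : 0 ≤ f (A + 2) := hf0 (A + 2) (by omega)
  have hgA21 : f (A + 2) ≤ f (A + 1) := by
    have := hmono (A + 1) (by omega); rwa [show A + 1 + 1 = A + 2 by ring] at this
  have hmon : ((A : ℝ) + 1) * f (A + 1) ≤ ((A : ℝ) + 2) * f (A + 2) := by
    have := succ_mul_g_le hσ1 (t := (A : ℝ) + 1) (by linarith)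
    simp only [hfdef]; push_cast
    rw [show (A : ℝ) + 1 + 1 = (A : ℝ) + 2 by ring] at this
    exact this
  have hI : -(((A : ℝ) * (A + 3) / 2) * f (A + 1)) + ((A : ℝ) * (A + 1) / 2) * f (A + 2) +
      R / 2 * (((A : ℝ) + 1) * f (A + 1) - (A : ℝ) * f (A + 2)) ≤
      -(((A : ℝ) - 3) / 2) * f (A + 1) := by
    have hbr : ((A : ℝ) + 1) * f (A + 1) - (A : ℝ) * f (A + 2) ≤ 2 * f (A + 2) := by linarith
    have hk := mul_le_mul_of_nonneg_left hbr (by linarith : (0:ℝ) ≤ (R - ((A : ℝ) + 1)) / 2)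
    have hk2 := mul_le_mul_of_nonneg_right hθ1 (by linarith : (0:ℝ) ≤ f (A + 2))
    have e : -(((A : ℝ) * (A + 3) / 2) * f (A + 1)) + ((A : ℝ) * (A + 1) / 2) * f (A + 2) +
        R / 2 * (((A : ℝ) + 1) * f (A + 1) - (A : ℝ) * f (A + 2)) =
        -(((A : ℝ) - 1) / 2) * f (A + 1) +
          (R - ((A : ℝ) + 1)) / 2 * (((A : ℝ) + 1) * f (A + 1) - (A : ℝ) * f (A + 2)) := by ring
    rw [e]
    have e2 : -(((A : ℝ) - 3) / 2) * f (A + 1) = -(((A : ℝ) - 1) / 2) * f (A + 1) + f (A + 1) := by ring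
    rw [e2]
    nlinarith
  -- (II) the head sum
  have hsumg : (∑ m ∈ Ico 6 (A + 1), f m) + g σ (2 : ℕ) + g σ (3 : ℕ) + f 4 + f 5 ≤
      (A : ℝ) ^ (1 - σ) * (Real.log A ^ 2 / 2 + 0.11) := by
    have hsplit : ∑ m ∈ Ico 2 (A + 1), f m = f 2 + f 3 + f 4 + f 5 + ∑ m ∈ Ico 6 (A + 1), f m := by
      rw [Finset.sum_eq_sum_Ico_succ_bot (show 2 < A + 1 by omega),
        Finset.sum_eq_sum_Ico_succ_bot (show 3 < A + 1 by omega),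
        Finset.sum_eq_sum_Ico_succ_bot (show 4 < A + 1 by omega),
        Finset.sum_eq_sum_Ico_succ_bot (show 5 < A + 1 by omega)]
      ring
    have hle : ∑ m ∈ Ico 2 (A + 1), f m ≤ ∑ m ∈ Ico 2 (A + 1), Real.log m / m * (A : ℝ) ^ (1 - σ) := by
      refine sum_le_sum fun m hm => ?_
      have hm2 : 2 ≤ m := (mem_Ico.mp hm).1
      have hmA : m ≤ A := by have := (mem_Ico.mp hm).2; omega
      exact g_le_log_div_mul hσ1 (by exact_mod_cast (show 1 ≤ m by omega)) (by exact_mod_cast hmA)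
    rw [← sum_mul] at hle
    have hlog := sum_log_div_le (show 4 ≤ A by omega)
    have hApow : 0 ≤ (A : ℝ) ^ (1 - σ) := Real.rpow_nonneg (by linarith) _
    calc (∑ m ∈ Ico 6 (A + 1), f m) + g σ (2 : ℕ) + g σ (3 : ℕ) + f 4 + f 5
        = ∑ m ∈ Ico 2 (A + 1), f m := by rw [hsplit]; simp only [hfdef]; ring
      _ ≤ (∑ m ∈ Ico 2 (A + 1), Real.log (m : ℝ) / (m : ℝ)) * (A : ℝ) ^ (1 - σ) := hle
      _ ≤ (Real.log A ^ 2 / 2 + 0.11) * (A : ℝ) ^ (1 - σ) := mul_le_mul_of_nonneg_right hlog hApow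
      _ = (A : ℝ) ^ (1 - σ) * (Real.log A ^ 2 / 2 + 0.11) := mul_comm _ _
  -- (III) `A^{1−σ} ≤ exp(50/(R L)) ≤ 1 + y + y²`
  obtain ⟨y, hydef⟩ : ∃ y : ℝ, y = 50 / (R * L) := ⟨_, rfl⟩
  have hy0 : 0 ≤ y := by rw [hydef]; positivity
  have hy1 : y ≤ 0.0064 := by
    rw [hydef, div_le_iff₀ (by positivity)]; nlinarith
  have hyL : y * L ^ 2 ≤ 3.125 := by
    have e : y * L ^ 2 = 50 * L / R := by rw [hydef]; field_simp
    rw [e, div_le_iff₀ hR0]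
    linarith
  have hlogA0 : 0 ≤ Real.log A := Real.log_nonneg (by linarith)
  have hlogA : Real.log A ≤ L / 2 := by
    have h1 : Real.log A ≤ Real.log R := Real.log_le_log (by linarith) (by linarith)
    linarith
  have hApow : (A : ℝ) ^ (1 - σ) ≤ 1 + y + y ^ 2 := by
    have hA0 : (0 : ℝ) < A := by linarith
    rw [Real.rpow_def_of_pos hA0]
    have hexp : Real.log A * (1 - σ) ≤ y := by
      calc Real.log A * (1 - σ) ≤ (L / 2) * (100 / (R * L ^ 2)) :=
            mul_le_mul hlogA hδ hδ0 (by linarith)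
        _ = y := by rw [hydef]; field_simp; ring
    calc Real.exp (Real.log A * (1 - σ)) ≤ Real.exp y := Real.exp_le_exp.mpr hexp
      _ ≤ 1 + y + y ^ 2 := exp_le_one_add_add_sq (by rw [abs_of_nonneg hy0]; linarith)
  have hhead : (A : ℝ) ^ (1 - σ) * (Real.log A ^ 2 / 2 + 0.11) ≤ 1 / 8 * L ^ 2 + 0.504 :=
    bound_head (Real.rpow_nonneg (by linarith) _) hApow hy0 hy1 hyL hlogA0 hlogA
  -- (IV) `18 f(4) − 12 f(5) ≤ 2.385`
  have h45 : 18 * f 4 - 12 * f 5 ≤ 2.385 := bound_small_terms hδ0 hδ1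
  -- (V) the negative term `−((A−3)/2) f(A+1) ≤ −3.198`
  have hneg : -(((A : ℝ) - 3) / 2) * f (A + 1) ≤ -3.198 := bound_negative_term hσ1 hA631
  -- assemble (all atoms aligned with `hmain`)
  have htot : (∑ m ∈ Ico 6 (A + 1), f m) + 10 * f 4 - 5 * f 5 - ((A : ℝ) * (A + 3) / 2) * f (A + 1) +
        ((A : ℝ) * (A + 1) / 2) * f (A + 2) + R / 2 * (((A : ℝ) + 1) * f (A + 1) - (A : ℝ) * f (A + 2)) +
        (9 * f 4 - 6 * f 5) + g σ (2 : ℕ) + g σ (3 : ℕ) ≤ 1 / 8 * L ^ 2 := by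
    linarith [hI, hsumg, hhead, h45, hneg]
  simp only [hfdef] at htot
  push_cast at hmain htot ⊢
  linarith [hmain, htot]

/-! ### Theorem 1.3 -/

/-- **Bordignon 2020, Theorem 1.3 for PRIMITIVE characters — PROVED, for every real zero and with
STRICT inequality:** for `q > 4·10⁵`, `χ` mod `q` primitive, real and even, and `L(β, χ) = 0` with
`β < 1` real, `β < 1 − 100/(√q log² q)`. Proof as in print ((4): `L(1,χ) = |L′(σ,χ)|(1 − β)` for some
`σ ∈ (β, 1)`, here as the mean-value inequality `DirichletAbel.norm_LFunction_one_sub_le_of_norm_deriv_le`):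
if `β` were inside the closed window then `|L′| ≤ ⅛ log² q` on `[β, 1]` (Theorem 1.1,
`bordignon2020_theorem11`) would give `|L(1,χ)| ≤ ⅛ log² q · (1 − β) ≤ 12.5/√q`, against
Theorem 1.2 (`bordignon2020_theorem12`: `L(1,χ) ≥ 12.52/√q`); the slack `12.5 < 12.52` makes the
inequality strict (the shape BGTZ 2025 Hypothesis 2.6 asks for). [cite: Bordignon2020, Theorem 1.3 (proof, §1 (4))] -/
theorem realZero_lt_bordignon_even_primitive (hq : 400000 < q) (hprim : χ.IsPrimitive)
    (hquad : χ.IsQuadratic) (heven : χ.Even) {β : ℝ} (hβ1 : β < 1) (hz : χ.LFunction β = 0) :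
    β < 1 - 100 / (Real.sqrt q * Real.log q ^ 2) := by
  have hlog := Bordignon.log_ge hq
  have hsqrt := Bordignon.sqrt_ge hq
  have hL : 0 < Real.log q := by linarith
  have hS : 0 < Real.sqrt q := by linarith
  have hx : 0 < Real.sqrt q * Real.log q ^ 2 := by positivity
  have hχ1 : χ ≠ 1 := by
    intro h1
    rw [DirichletCharacter.isPrimitive_def, h1, DirichletCharacter.conductor_one] at hprim
    omega
  by_contra hβ
  rw [not_lt] at hβ
  -- `|L′| ≤ ⅛ log² q` on `[β, 1]`
  have hmv := DirichletAbel.norm_LFunction_one_sub_le_of_norm_deriv_le χ hχ1 hβ1.le fun σ h1 h2 =>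
    bordignon2020_theorem11 χ hq hprim hquad heven (le_trans hβ h1) h2
  rw [hz, sub_zero] at hmv
  -- `L(1, χ) ≥ 12.52/√q`
  have h12 := bordignon2020_theorem12 q χ hq hprim hquad heven
  have hre : (χ.LFunction 1).re ≤ ‖χ.LFunction 1‖ := Complex.re_le_norm _
  -- `⅛ log² q · (1 − β) ≤ 12.5/√q`
  have hle : 1 / 8 * Real.log q ^ 2 * (1 - β) ≤ 12.5 / Real.sqrt q := by
    have h1 : 1 - β ≤ 100 / (Real.sqrt q * Real.log q ^ 2) := by linarith
    calc 1 / 8 * Real.log q ^ 2 * (1 - β) ≤ 1 / 8 * Real.log q ^ 2 * (100 / (Real.sqrt q * Real.log q ^ 2)) :=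
          mul_le_mul_of_nonneg_left h1 (by positivity)
      _ = 12.5 / Real.sqrt q := by field_simp; ring
  have h1252 : 12.5 / Real.sqrt q < 12.52 / Real.sqrt q := div_lt_div_of_pos_right (by norm_num) hS
  linarith

/-- **Bordignon 2020, Theorem 1.3 for PRIMITIVE characters — PROVED, in the printed `≤` shape** (and for
every real zero `β < 1`, not only the exceptional one): `β ≤ 1 − 100/(√q log² q)`.
[cite: Bordignon2020, Theorem 1.3] -/
theorem one_sub_realZero_bordignon_even_primitive (hq : 400000 < q) (hprim : χ.IsPrimitive)
    (hquad : χ.IsQuadratic) (heven : χ.Even) {β : ℝ} (hβ1 : β < 1) (hz : χ.LFunction β = 0) :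
    β ≤ 1 - 100 / (Real.sqrt q * Real.log q ^ 2) :=
  (realZero_lt_bordignon_even_primitive χ hq hprim hquad heven hβ1 hz).le

omit [NeZero q] in
/-- The primitive character of an even character is even (`χ⋆(−1) = χ(−1)`, `−1` being coprime to the
level). [folklore] -/
private theorem primitiveCharacter_even' {χ : DirichletCharacter ℂ q} (heven : χ.Even) :
    χ.primitiveCharacter.Even := by
  have h := DirichletCharacter.primitiveCharacter_apply_of_isCoprime χ (a := -1)
    (isCoprime_one_left.neg_left)
  rw [DirichletCharacter.Even]
  push_cast at h
  rw [h]
  exact heven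

/-- `√x · log² x` is monotone on `[1, ∞)`. [folklore] -/
private theorem sqrt_mul_log_sq_mono {x y : ℝ} (hx : 1 ≤ x) (hxy : x ≤ y) :
    Real.sqrt x * Real.log x ^ 2 ≤ Real.sqrt y * Real.log y ^ 2 := by
  have hlx : 0 ≤ Real.log x := Real.log_nonneg hx
  have hlxy : Real.log x ≤ Real.log y := Real.log_le_log (by linarith) hxy
  exact mul_le_mul (Real.sqrt_le_sqrt hxy) (pow_le_pow_left₀ hlx hlxy 2) (by positivity)
    (Real.sqrt_nonneg _)

/-- **Bordignon 2020, Theorem 1.3 for ALL even non-principal real characters and every real zero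
`β < 1`, STRICT, modulo the narrow leaf `NoExceptionalZeroUpTo 4·10⁵ (1/5)`** (the reduction to the primitive
character in print: «if `χ` is induced by a primitive `χ′` mod `q′ ≤ 4·10⁵`, `L(s,χ′)` satisfies RH up
to height `10⁸` [Platt] and does not have exceptional zeros» — the tree cannot reproduce Platt's
computation, so that range enters as the hypothesis `h`; any narrow width `c₀` with
`500·log q′ ≤ c₀⁻¹·… `, here `c₀ = 1/5`, suffices since `√q log q ≥ 7900`). Route: `β ≤ 0` is trivial
(`100/(√q log² q) < 1`); for `0 < β < 1` pass to `χ⋆` mod `q′ ∣ q`, `3 ≤ q′ ≤ q`, primitive, real,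
even, `L(β, χ⋆) = 0`; if `q′ > 4·10⁵`, `one_sub_realZero_bordignon_even_primitive` at level `q′` and
`√q′ log² q′ ≤ √q log² q`; if `q′ ≤ 4·10⁵`, the leaf gives `β < 1 − 1/(5 log q′)` and
`500 log q′ ≤ 500 log q ≤ √q log² q`. STRICT inequality throughout (as in the primitive case).
[cite: Bordignon2020, Theorem 1.3 (proof, last paragraph)] [cite: Platt2016GRH, Theorem 7.1] -/
theorem realZero_lt_bordignon_even_of_noExceptionalZeroUpTo
    (h : NoExceptionalZeroUpTo 400000 (1 / 5)) (hq : 400000 < q) (hquad : χ.IsQuadratic)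
    (hχ : χ ≠ 1) (heven : χ.Even) {β : ℝ} (hβ1 : β < 1) (hz : χ.LFunction β = 0) :
    β < 1 - 100 / (Real.sqrt q * Real.log q ^ 2) := by
  have hlog := Bordignon.log_ge hq
  have hsqrt := Bordignon.sqrt_ge hq
  have hL : 0 < Real.log q := by linarith
  have hS : 0 < Real.sqrt q := by linarith
  have hx : 0 < Real.sqrt q * Real.log q ^ 2 := by positivity
  have hwin1 : 100 / (Real.sqrt q * Real.log q ^ 2) < 1 := by
    rw [div_lt_one hx]; nlinarith
  rcases le_or_gt β 0 with hβ0 | hβ0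
  · linarith
  -- `0 < β < 1`: pass to the primitive character
  haveI : NeZero χ.conductor := ⟨χ.conductor_ne_zero⟩
  set ψ := χ.primitiveCharacter with hψdef
  have hχψ : DirichletCharacter.changeLevel χ.conductor_dvd_level ψ = χ :=
    DirichletCharacter.changeLevel_primitiveCharacter χ
  have hψ1 : ψ ≠ 1 := fun h' => hχ (by rw [← hχψ, h', map_one])
  have hsq : χ ^ 2 = 1 := MulChar.isQuadratic_iff_sq_eq_one.mp hquad
  have hψsq : ψ ^ 2 = 1 :=
    DirichletCharacter.changeLevel_injective χ.conductor_dvd_level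
      (by rw [map_pow, hχψ, hsq, map_one])
  have hψquad : ψ.IsQuadratic := MulChar.isQuadratic_iff_sq_eq_one.mpr hψsq
  have hψprim : ψ.IsPrimitive := DirichletCharacter.primitiveCharacter_isPrimitive χ
  have hψeven : ψ.Even := primitiveCharacter_even' heven
  have hd3 : 3 ≤ χ.conductor := Literature.Barriers.Parity.SiegelZeroPrimePairBarrierNarrow.three_le_level_of_ne_one ψ hψ1
  have hdq : χ.conductor ≤ q := Nat.le_of_dvd (Nat.pos_of_ne_zero (NeZero.ne q)) χ.conductor_dvd_level
  have hzψ : ψ.LFunction β = 0 :=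
    (DirichletCharacter.LFunction_eq_zero_iff_primitiveCharacter χ (s := (β : ℂ))
      (by simpa using hβ0) (by
        intro h1
        have := congrArg Complex.re h1
        simp at this
        linarith)).mp hz
  have hd3R : (3 : ℝ) ≤ χ.conductor := by exact_mod_cast hd3
  have hdqR : (χ.conductor : ℝ) ≤ q := by exact_mod_cast hdq
  have hlogd : 0 < Real.log (χ.conductor : ℝ) := Real.log_pos (by linarith)
  have hlogdq : Real.log (χ.conductor : ℝ) ≤ Real.log q := Real.log_le_log (by linarith) hdqR
  rcases lt_or_ge 400000 χ.conductor with hd | hd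
  · -- large conductor: the primitive theorem at level `q′`, and monotonicity of `√x log² x`
    have hprimd := realZero_lt_bordignon_even_primitive ψ hd hψprim hψquad hψeven hβ1 hzψ
    have hxd : 0 < Real.sqrt (χ.conductor : ℝ) * Real.log (χ.conductor : ℝ) ^ 2 :=
      Bordignon.sqrt_mul_log_sq_pos hd
    have hmono : Real.sqrt (χ.conductor : ℝ) * Real.log (χ.conductor : ℝ) ^ 2 ≤
        Real.sqrt q * Real.log q ^ 2 := sqrt_mul_log_sq_mono (by linarith) hdqR
    have : 100 / (Real.sqrt q * Real.log q ^ 2) ≤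
        100 / (Real.sqrt (χ.conductor : ℝ) * Real.log (χ.conductor : ℝ) ^ 2) :=
      div_le_div_of_nonneg_left (by norm_num) hxd hmono
    linarith
  · -- small conductor: the leaf excludes `[1 − 1/(5 log q′), 1]`
    have hβlt : β < 1 - 1 / 5 / Real.log (χ.conductor : ℝ) := by
      by_contra hge
      rw [not_lt] at hge
      exact h χ.conductor hd3 hd ψ hψquad hψprim β hβ0 hge hβ1.le hzψ
    have hwin : 100 / (Real.sqrt q * Real.log q ^ 2) ≤ 1 / 5 / Real.log (χ.conductor : ℝ) := by
      rw [div_le_div_iff₀ hx hlogd]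
      nlinarith
    linarith

/-- The printed `≤` shape of the previous theorem. [cite: Bordignon2020, Theorem 1.3] -/
theorem one_sub_realZero_bordignon_even_of_noExceptionalZeroUpTo
    (h : NoExceptionalZeroUpTo 400000 (1 / 5)) (hq : 400000 < q) (hquad : χ.IsQuadratic)
    (hχ : χ ≠ 1) (heven : χ.Even) {β : ℝ} (hβ1 : β < 1) (hz : χ.LFunction β = 0) :
    β ≤ 1 - 100 / (Real.sqrt q * Real.log q ^ 2) :=
  (realZero_lt_bordignon_even_of_noExceptionalZeroUpTo χ h hq hquad hχ heven hβ1 hz).le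

/-- **`bordignon2020_theorem13` follows from the narrow leaf `NoExceptionalZeroUpTo_4e5_fifth`**
(in the fact's own shape; the region hypothesis `β₀ ≥ 1 − 1/(9.6459 log q)` is not needed).
[cite: Bordignon2020, Theorem 1.3] [cite: LuZamanZhao2026, Theorem 1.1] -/
theorem bordignon2020_theorem13_of_noExceptionalZeroUpTo (h : NoExceptionalZeroUpTo_4e5_fifth) :
    bordignon2020_theorem13 := by
  intro q _ hq χ hquad hχ heven β₀ hz _
  have hβ1 : β₀ < 1 := by
    by_contra hge
    exact DirichletCharacter.LFunction_ne_zero_of_one_le_re χ (Or.inl hχ)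
      (by simpa using not_lt.mp hge) hz
  exact one_sub_realZero_bordignon_even_of_noExceptionalZeroUpTo χ h hq hquad hχ heven hβ1 hz

/-- **`bordignon2020_theorem13` follows from Platt's Theorem 7.1** (`platt2016_theorem71`, the
certified computation the source itself invokes for `q′ ≤ 4·10⁵`), through
`noExceptionalZeroUpTo_platt : NoExceptionalZeroUpTo 4·10⁵ (1/2)` and `anti_const`. So the 2020
theorem adds no debt beyond Platt's table. [cite: Bordignon2020, Theorem 1.3] [cite: Platt2016GRH, Theorem 7.1] -/
theorem bordignon2020_theorem13_of_platt (hP : platt2016_theorem71) : bordignon2020_theorem13 :=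
  bordignon2020_theorem13_of_noExceptionalZeroUpTo
    ((noExceptionalZeroUpTo_platt hP).anti_const (by norm_num))

end Bordignon2020

/-! ### BGTZ 2025 Theorem 2.8 (`theorem28_bordignon` = Hypothesis 2.6 with `ε = ½`, `B = 100`)
DISCHARGED modulo the instrument facts -/

/-- The principal `L`-function has no real zero in `(0, 1)`: `L(σ, χ₀) = ζ(σ) ∏_{p ∣ q}(1 − p^{−σ})`
(Mathlib `LFunctionTrivChar_eq_mul_riemannZeta`), `ζ(σ) ≠ 0` on `(0,1)` (`ZetaRealAxis`), and
`p^{−σ} < 1`. (Same as the private lemma of `ExplicitExceptionalZeroBoundsRealCharacters`.) [folklore] -/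
private theorem LFunction_one_ofReal_ne_zero' {q : ℕ} [NeZero q] {σ : ℝ} (h0 : 0 < σ) (h1 : σ < 1) :
    (1 : DirichletCharacter ℂ q).LFunction σ ≠ 0 := by
  have hs1 : (σ : ℂ) ≠ 1 := by
    intro h; have := congrArg Complex.re h; simp at this; linarith
  have key : (1 : DirichletCharacter ℂ q).LFunction σ =
      (∏ p ∈ q.primeFactors, (1 - (p : ℂ) ^ (-(σ : ℂ)))) * riemannZeta σ :=
    DirichletCharacter.LFunctionTrivChar_eq_mul_riemannZeta hs1
  rw [key]
  refine mul_ne_zero (Finset.prod_ne_zero_iff.mpr fun p hp => ?_)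
    (riemannZeta_ofReal_ne_zero_of_pos_of_lt_one σ h0 h1)
  have hp := Nat.prime_of_mem_primeFactors hp
  have hlt : ‖(p : ℂ) ^ (-(σ : ℂ))‖ < 1 := by
    rw [Complex.norm_natCast_cpow_of_pos hp.pos]
    simp only [neg_re, ofReal_re]
    exact Real.rpow_lt_one_of_one_lt_of_neg (by exact_mod_cast hp.one_lt) (by linarith)
  intro h
  rw [sub_eq_zero] at h
  rw [← h, norm_one] at hlt
  exact lt_irrefl _ hlt

/-- **`BGTZ2025.HypothesisB B (1/2)` reduces to its REAL-CHARACTER clause at `q > 4·10⁵`**, modulo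
Platt 2016 Thm 7.1 and McCurley 1984 Thm 1: for `3 ≤ q ≤ 4·10⁵` no `L(s,χ)` mod `q` has a real zero in
`(0,1)` (Platt, `grhUpTo_of_platt2016`; the principal character directly); for `q > 4·10⁵` a zero
`β₁ > 1 − 1/(10 log q)` of a complex `χ` is excluded by McCurley's theorem (`R = 9.645908801 < 10`), and
the principal character has none; what is left is exactly the clause `hreal` on non-principal real `χ`.
(The reduction inside `BGTZ2025.hypothesisB_of_bordignon`, isolated so that the clause can be fed by its
dischargers.) [cite: BenliGoelTwissZaman2025, Hypothesis 2.6 and Theorem 2.8]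
[cite: Platt2016GRH, Theorem 7.1] [cite: McCurley1984ZFR, Theorem 1] -/
theorem BGTZ2025.hypothesisB_half_of_real_clause {B : ℝ}
    (hreal : ∀ (q : ℕ) [NeZero q], 400000 < q → ∀ χ : DirichletCharacter ℂ q, χ.IsQuadratic → χ ≠ 1 →
      ∀ β : ℝ, 1 - 1 / (10 * Real.log q) < β → β < 1 → χ.LFunction β = 0 →
        β < 1 - B / (Real.sqrt q * Real.log q ^ 2))
    (hP : platt2016_theorem71) (hM : McCurley1984_theorem1) : BGTZ2025.HypothesisB B (1 / 2) := by
  intro q _ hq3 χ β₁ hlo hβ1 hz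
  have hq0 : (0 : ℝ) < q := by exact_mod_cast (show 0 < q by omega)
  have hq3R : (3 : ℝ) ≤ q := by exact_mod_cast hq3
  have hlog3 : 1 < Real.log 3 := by
    rw [Real.lt_log_iff_exp_lt (by norm_num)]
    linarith [Real.exp_one_lt_d9]
  have hlogq : 1 < Real.log q := lt_of_lt_of_le hlog3 (Real.log_le_log (by norm_num) hq3R)
  have hβ0 : 0 < β₁ := by
    have : 1 / (10 * Real.log q) < 1 := by
      rw [div_lt_one (by positivity)]; linarith
    linarith
  have hsqrt : (q : ℝ) ^ (1 / 2 : ℝ) = Real.sqrt q := (Real.sqrt_eq_rpow (q : ℝ)).symm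
  rw [hsqrt]
  -- the principal character has no real zero in `(0,1)`
  by_cases hχ1 : χ = 1
  · subst hχ1
    exact absurd hz (LFunction_one_ofReal_ne_zero' hβ0 hβ1)
  rcases le_or_gt q 400000 with hq | hq
  · -- Platt: no zero off the line up to height `10⁸/q`; a real zero in `(0,1)` would lie on `Re s = ½`
    have hgrh := grhUpTo_of_platt2016 (q := q) hP hq χ hχ1
    have hhalf : ((β₁ : ℂ)).re = 1 / 2 :=
      hgrh β₁ hz (by simpa using hβ0) (by simpa using hβ1)
        (by simp only [Complex.ofReal_im, abs_zero]; positivity)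
    simp at hhalf
    have : 1 / (10 * Real.log q) ≤ 1 / 10 := by
      rw [div_le_div_iff₀ (by positivity) (by norm_num)]; nlinarith
    linarith
  · -- `q > 4·10⁵`
    by_cases hsq : χ ^ 2 = 1
    · exact hreal q hq χ (MulChar.isQuadratic_iff_sq_eq_one.mpr hsq) hχ1 β₁ hlo hβ1 hz
    · -- complex `χ`: McCurley's theorem puts no zero of `L(s,χ)` that close to `1`
      exfalso
      have hq10 : (10 : ℝ) ≤ q := by
        have : (400000 : ℝ) < q := by exact_mod_cast hq
        linarith
      have hmax : max (max (q : ℝ) ((q : ℝ) * |((β₁ : ℂ)).im|)) 10 = q := by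
        simp only [Complex.ofReal_im, abs_zero, mul_zero]
        rw [max_eq_left hq0.le, max_eq_left hq10]
      have hβne : (β₁ : ℂ) ≠ 1 := by
        intro h; have := congrArg Complex.re h; simp at this; linarith
      have hregM : 1 - 1 / (9.645908801 * Real.log (max (max (q : ℝ) ((q : ℝ) * |((β₁ : ℂ)).im|)) 10)) <
          ((β₁ : ℂ)).re := by
        rw [hmax]
        simp only [Complex.ofReal_re]
        have : 1 / (10 * Real.log q) ≤ 1 / (9.645908801 * Real.log q) :=
          div_le_div_of_nonneg_left (by norm_num) (by positivity) (by nlinarith)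
        linarith
      have key := hM q hq3 χ χ (β₁ : ℂ) (β₁ : ℂ) hβne hβne hregM hregM hz hz
      exact hsq key.2.2.2

/-- **The real-character clause with `B = 100`, STRICT, from Watkins' two 2004 tables and Platt 2016
Thm 7.1**: for `q > 4·10⁵`, `χ` mod `q` real non-principal and `L(β,χ) = 0` with `β < 1` real,
`β < 1 − 100/(√q log² q)` — odd `χ`: `β ≤ 1 − 800/(√q log² q)` (`one_sub_realZero_bordignon_odd_of_watkins`,
Bordignon 2019 Thm 1.3 derived from `watkins2004_theorem` ∧ `watkins2004_table4`) and `800 > 100`; even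
`χ`: `Bordignon2020.realZero_lt_bordignon_even_of_noExceptionalZeroUpTo` with Platt's range
(`noExceptionalZeroUpTo_platt`, constant `1/2 ≥ 1/5`). [cite: Bordignon2020, Theorem 1.3]
[cite: Bordignon2019, Theorem 1.3] [cite: Platt2016GRH, Theorem 7.1] [cite: Watkins2004ClassNumbers, Table 4 p. 936] -/
theorem BGTZ2025.realZero_lt_hundred_of_watkins_platt (hZ : watkins2004_theorem) (hW : QuadraticFields.watkins2004_table4)
    (hP : platt2016_theorem71) {q : ℕ} [NeZero q] (hq : 400000 < q) {χ : DirichletCharacter ℂ q}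
    (hquad : χ.IsQuadratic) (hχ : χ ≠ 1) {β : ℝ} (hβ1 : β < 1) (hz : χ.LFunction β = 0) :
    β < 1 - 100 / (Real.sqrt q * Real.log q ^ 2) := by
  rcases χ.even_or_odd with heven | hodd
  · exact Bordignon2020.realZero_lt_bordignon_even_of_noExceptionalZeroUpTo χ
      ((noExceptionalZeroUpTo_platt hP).anti_const (by norm_num)) hq hquad hχ heven hβ1 hz
  · have h := one_sub_realZero_bordignon_odd_of_watkins hZ hW hq hquad hχ hodd hβ1 hz
    have hx := Bordignon.sqrt_mul_log_sq_pos hq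
    have : 100 / (Real.sqrt q * Real.log q ^ 2) < 800 / (Real.sqrt q * Real.log q ^ 2) :=
      div_lt_div_of_pos_right (by norm_num) hx
    linarith

/-- **BGTZ 2025, Theorem 2.8 — the named fact `BGTZ2025.theorem28_bordignon` (`HypothesisB 100 (1/2)`:
«Hypothesis 2.6 holds with `ε = 1/2` and `B = 100`») DISCHARGED modulo the four instrument facts
`watkins2004_theorem`, `watkins2004_table4` (Watkins' 2004 certified tables), `platt2016_theorem71`
(Platt's certified GRH computation to `4·10⁵`) and `McCurley1984_theorem1` (McCurley's printed explicit
zero-free region).** With the strict `<` at `B = 100` exactly as the source states it: the strictness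
comes from the slack `12.5 < 12.52` in Bordignon's argument (`Bordignon2020.realZero_lt_bordignon_even_primitive`)
and from `800 > 100` on the odd side — so the typing note of `BGTZ2025.hypothesisB_of_bordignon` (that the
printed `≤ 100` does not literally give `< 100`) is resolved by the proofs, not by the statements. Both of
Bordignon's theorems drop out of the provenance. [cite: BenliGoelTwissZaman2025, Theorem 2.8]
[cite: Bordignon2020, Theorems 1.1 and 1.3] [cite: Platt2016GRH, Theorem 7.1] [cite: McCurley1984ZFR, Theorem 1]
[cite: Watkins2004ClassNumbers, Table 4 p. 936] -/
theorem BGTZ2025.theorem28_bordignon_of_watkins_platt_mccurley (hZ : watkins2004_theorem)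
    (hW : QuadraticFields.watkins2004_table4) (hP : platt2016_theorem71) (hM : McCurley1984_theorem1) :
    BGTZ2025.theorem28_bordignon :=
  BGTZ2025.hypothesisB_half_of_real_clause
    (fun _ _ hq _ hquad hχ _ _ hβ1 hz => BGTZ2025.realZero_lt_hundred_of_watkins_platt hZ hW hP hq hquad hχ hβ1 hz)
    hP hM

/-- `BGTZ2025.HypothesisB B (1/2)` for every `B ≤ 100` from the same four instrument facts
(`HypothesisB.anti`). [cite: BenliGoelTwissZaman2025, Hypothesis 2.6 and Theorem 2.8] -/
theorem BGTZ2025.hypothesisB_of_watkins_platt_mccurley (hZ : watkins2004_theorem) (hW : QuadraticFields.watkins2004_table4)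
    (hP : platt2016_theorem71) (hM : McCurley1984_theorem1) {B : ℝ} (hB : B ≤ 100) :
    BGTZ2025.HypothesisB B (1 / 2) :=
  BGTZ2025.HypothesisB.anti hB (BGTZ2025.theorem28_bordignon_of_watkins_platt_mccurley hZ hW hP hM)

end Literature.NumberTheory.LFunctions

end
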